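import Summits.Ventures.HSemireg.WedgeMixedBox

/-!
# Venture HSemireg — THE KÜNNETH IMAGE LAW: the image of `θ ↦ θ ∧ (f₁ ∧ f₂)` is generated by the images of the factors,
# `V(D₁ ⊔ D₂, f₁f₂, k) = Σ_{a+b=k} V(D₁, f₁, a) ∧ V(D₂, f₂, b)` — the submodule behind th-7's rank multiplicativity, and its iteration

HONEST FRAMING. Part of the Lean index of the computation cell `pub-hsemireg` (seat p10 gen 13, Sunday typer «UNIFORM-IN-n»).
Finite-dimensional EXTERIOR ALGEBRA over a field ONLY: no variety, no cohomology theory, no sheaf, no Ext group and no semiregularity map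
is constructed here; nothing here says that HC / HC_CM / HC_AV holds; no Literature fact is declared or used.  Custodian versions cited:
theory/FORMULA-N.md PART A §2.3 THEOREM K («rank polynomials MULTIPLY»), PART B §A.3 / §N.3 / §N.7 (a), §C.4–§C.5 (the bidegree bookkeeping
`I_k(E) = ⊕_{i+j=k} I_i ⊗ I′_j` of images on a product, there on the `τ`-side); STRUCTURE.md v1.0-SIGNED 9b196a05977dd067 §1.1 C19.  The
dictionary (`im(⌟ch(E ⊠ E′) ∣ HT^k)` ↔ th-7's factor rank spaces `V`) is QUOTED, never asserted.

WHAT IS IN THE TREE.  THEOREM K_lin (`WedgeKunneth.finrank_V_mul`, th-7): `dim V_{D₁⊔D₂}(f₁f₂, k) = Σ_{a+b=k} dim V_{D₁}(f₁,a) · dim V_{D₂}(f₂,b)`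
— inside its proof the image of the product is identified with the span of the products of bases of the factor images, but only the COUNT is
exported.  THIS FILE (PLAIN on the tree) exports the SUBMODULE statement and iterates it:
* §1 **`V_mul_V_le`, `iSup_V_mul_V_le`, THE KÜNNETH IMAGE LAW `V_union_mul_eq`: `V(D₁ ⊔ D₂, f₁f₂, k) = Σ_{a ≤ k} V(D₁, f₁, a) ∧ V(D₂, f₂, k − a)`** for
  disjoint blocks and homogeneous `f₁ ∈ Hom(D₁, d₁)` (`f₂` arbitrary): the image of a box in each degree is generated, bidegree by bidegree, by the
  products of the factors' images (`E_s ∧ f₁f₂ = ± (E_{s∩D₁} ∧ f₁) ∧ (E_{s∩D₂} ∧ f₂)`, th-7's `B_mul_mul`, and back).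
  Wedge-range form **`range_wedge_mul_eq`** when the blocks cover the generators.
* §2 ANY FINITE SPLITTING (gen 6's `prodR`): the recursion **`V_prodR_succ`** and `V_prodR_mul_V_le`.
With gen 13's KÜNNETH KERNEL LAW (`WedgeKunnethKernel`, keyed 712) both sides of `θ ↦ θ ∧ F` on a product — kernel AND image — are named by the
factors'.  NOT typed here: Hankel specialisations (they are `V_union_mul_eq` with th-7's `rankPoly_w`, by value); anything Ext-side.  Class side only.
Namespace `Summit.Ventures.HSemireg.Wedge.KunnethImage` (new); new names only.
-/

open Module

namespace Summit.Ventures.HSemireg.Wedge.KunnethImage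

open Summit.Ventures.HSemireg.Wedge Summit.Ventures.HSemireg.Wedge.Kunneth Summit.Ventures.HSemireg.Wedge.MixedBox

variable (K : Type*) [Field K] {I : Type*} [LinearOrder I] [Fintype I]

/-! ## §1. The Künneth image law -/

/-- **products of factor images lie in the image of the product: `V(D₁, f₁, a) ∧ V(D₂, f₂, b) ≤ V(D₁ ⊔ D₂, f₁f₂, a+b)`**
(`(E_{s₁} ∧ f₁) ∧ (E_{s₂} ∧ f₂) = ± E_{s₁ ∪ s₂} ∧ f₁f₂`). -/
theorem V_mul_V_le {D₁ D₂ : Finset I} (hD : Disjoint D₁ D₂) {d₁ : ℕ} {f₁ : HT K I} (hf₁ : f₁ ∈ Hom K I D₁ d₁) (f₂ : HT K I)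
    (a b : ℕ) : V K I D₁ f₁ a * V K I D₂ f₂ b ≤ V K I (D₁ ∪ D₂) (f₁ * f₂) (a + b) := by
  rw [V, V, Submodule.span_mul_span, Submodule.span_le, V]
  rintro _ ⟨_, ⟨s₁, ⟨hs₁, hc₁⟩, rfl⟩, _, ⟨s₂, ⟨hs₂, hc₂⟩, rfl⟩, rfl⟩
  show (B K I s₁ * f₁) * (B K I s₂ * f₂) ∈ _
  have hdisj : Disjoint s₁ s₂ := disjoint_of_subsets hD hs₁ hs₂
  have heq : (B K I s₁ * f₁) * (B K I s₂ * f₂) = ((-1 : K) ^ (s₂.card * d₁) * u K s₁ s₂) • (B K I (s₁ ∪ s₂) * (f₁ * f₂)) := by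
    rw [mul_assoc, ← mul_assoc f₁, show f₁ * B K I s₂ = ((-1 : K) ^ (s₂.card * d₁)) • (B K I s₂ * f₁) from ?_, smul_mul_assoc,
      mul_smul_comm, mul_assoc, ← mul_assoc (B K I s₁), B_mul_B, smul_mul_assoc, smul_smul]
    rw [B_mul_comm_of_mem_Hom K hf₁ s₂, smul_smul, ← pow_add, ← two_mul, pow_mul, neg_one_sq, one_pow, one_smul]
  rw [heq]
  refine Submodule.smul_mem _ _ (Submodule.subset_span ⟨s₁ ∪ s₂, ⟨Finset.union_subset_union hs₁ hs₂, ?_⟩, rfl⟩)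
  rw [Finset.card_union_of_disjoint hdisj, hc₁, hc₂]

/-- the Künneth image sum `Σ_{a ≤ k} V(D₁, f₁, a) ∧ V(D₂, f₂, k − a)` lies in the image of the product. -/
theorem iSup_V_mul_V_le {D₁ D₂ : Finset I} (hD : Disjoint D₁ D₂) {d₁ : ℕ} {f₁ : HT K I} (hf₁ : f₁ ∈ Hom K I D₁ d₁) (f₂ : HT K I) (k : ℕ) :
    (⨆ a ∈ Finset.range (k + 1), V K I D₁ f₁ a * V K I D₂ f₂ (k - a)) ≤ V K I (D₁ ∪ D₂) (f₁ * f₂) k := by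
  refine iSup₂_le fun a ha => ?_
  have hak : a + (k - a) = k := by rw [Finset.mem_range] at ha; omega
  exact (V_mul_V_le K hD hf₁ f₂ a (k - a)).trans (by rw [hak])

/-- **THE KÜNNETH IMAGE LAW: `V(D₁ ⊔ D₂, f₁f₂, k) = Σ_{a ≤ k} V(D₁, f₁, a) ∧ V(D₂, f₂, k − a)`** — for disjoint blocks, homogeneous `f₁ ∈ Hom(D₁, d₁)`
and any `f₂`, every field and degree: the image of `θ ↦ θ ∧ f₁f₂` on the degree-`k` forms of `D₁ ⊔ D₂` is generated, bidegree by bidegree, by the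
products of the factors' images (the submodule behind th-7's `finrank_V_mul`). -/
theorem V_union_mul_eq {D₁ D₂ : Finset I} (hD : Disjoint D₁ D₂) {d₁ : ℕ} {f₁ : HT K I} (hf₁ : f₁ ∈ Hom K I D₁ d₁) (f₂ : HT K I) (k : ℕ) :
    V K I (D₁ ∪ D₂) (f₁ * f₂) k = ⨆ a ∈ Finset.range (k + 1), V K I D₁ f₁ a * V K I D₂ f₂ (k - a) := by
  classical
  refine le_antisymm ?_ (iSup_V_mul_V_le K hD hf₁ f₂ k)
  rw [V, Submodule.span_le]
  rintro _ ⟨s, ⟨hsD, hs⟩, rfl⟩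
  show B K I s * (f₁ * f₂) ∈ _
  rw [B_mul_mul K hD hf₁ f₂ hsD]
  have hcard : (s ∩ D₁).card + (s ∩ D₂).card = k := by
    rw [← Finset.card_union_of_disjoint (disjoint_of_subsets hD Finset.inter_subset_right Finset.inter_subset_right),
      ← Finset.inter_union_distrib_left, Finset.inter_eq_left.mpr hsD, hs]
  refine Submodule.smul_mem _ _ (Submodule.mem_iSup_of_mem (s ∩ D₁).card (Submodule.mem_iSup_of_mem (Finset.mem_range.mpr (by omega))
    (Submodule.mul_mem_mul (Submodule.subset_span ⟨s ∩ D₁, ⟨Finset.inter_subset_right, rfl⟩, rfl⟩)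
      (Submodule.subset_span ⟨s ∩ D₂, ⟨Finset.inter_subset_right, by omega⟩, rfl⟩))))

/-- **WEDGE-RANGE FORM: `range(θ ↦ θ ∧ f₁f₂ ∣ ⋀^k) = Σ_{a ≤ k} V(D₁, f₁, a) ∧ V(D₂, f₂, k − a)`** when the two blocks cover the generators. -/
theorem range_wedge_mul_eq {D₁ D₂ : Finset I} (hD : Disjoint D₁ D₂) (hcov : D₁ ∪ D₂ = Finset.univ) {d₁ : ℕ} {f₁ : HT K I}
    (hf₁ : f₁ ∈ Hom K I D₁ d₁) (f₂ : HT K I) (k : ℕ) :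
    LinearMap.range (wedge K I k (f₁ * f₂)) = ⨆ a ∈ Finset.range (k + 1), V K I D₁ f₁ a * V K I D₂ f₂ (k - a) := by
  rw [← V_univ, ← hcov, V_union_mul_eq K hD hf₁ f₂ k]

/-! ## §2. Any finite splitting -/

section Split

variable {n : ℕ} {D : ℕ → Finset I} {d : ℕ → ℕ} {f : ℕ → HT K I}

/-- **THE RECURSIVE KÜNNETH IMAGE LAW over a finite splitting**: for pairwise disjoint blocks `D 0, …, D (n−1)` and homogeneous
`f i ∈ Hom(D i, d i)`, the image of the prefix product `f 0 ∧ ⋯ ∧ f j` (`1 ≤ j < n`) in every degree is the Künneth image sum of the previous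
prefix product and the new factor. -/
theorem V_prodR_succ (hf : ∀ i, i < n → f i ∈ Hom K I (D i) (d i)) (hD : ∀ i j, i < j → j < n → Disjoint (D i) (D j))
    {j : ℕ} (hj1 : 1 ≤ j) (hjn : j < n) (k : ℕ) :
    V K I ((Finset.range (j + 1)).biUnion D) (prodR K f (j + 1)) k =
      ⨆ a ∈ Finset.range (k + 1), V K I ((Finset.range j).biUnion D) (prodR K f j) a * V K I (D j) (f j) (k - a) := by
  rw [biUnion_range_succ, prodR_succ]
  exact V_union_mul_eq K (disjoint_biUnion_range hD hjn) (rankPoly_prodR K hf hD j hj1 hjn.le).1 (f j) k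

/-- one factor's image times anything already generated: **`V(prefix j, F_j, a) ∧ V(D_j, f_j, b) ≤ V(prefix (j+1), F_{j+1}, a + b)`** (`1 ≤ j < n`). -/
theorem V_prodR_mul_V_le (hf : ∀ i, i < n → f i ∈ Hom K I (D i) (d i)) (hD : ∀ i j, i < j → j < n → Disjoint (D i) (D j))
    {j : ℕ} (hj1 : 1 ≤ j) (hjn : j < n) (a b : ℕ) :
    V K I ((Finset.range j).biUnion D) (prodR K f j) a * V K I (D j) (f j) b ≤ V K I ((Finset.range (j + 1)).biUnion D) (prodR K f (j + 1)) (a + b) := by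
  rw [biUnion_range_succ, prodR_succ]
  exact V_mul_V_le K (disjoint_biUnion_range hD hjn) (rankPoly_prodR K hf hD j hj1 hjn.le).1 (f j) a b

end Split

end Summit.Ventures.HSemireg.Wedge.KunnethImage
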